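import Literature.Analysis.FluidPDE.LeiRenZhang2019Liouville
import HarnessLib

/-!
# Lei–Ren–Zhang 2019, proof of Theorem 1.1: the reduction to `Γ ≡ 0` in the bounded weak class

Analysis/FluidPDE proofs file (theorems only, no definitions, no named facts), on the discharge
path of the named fact `Literature.Analysis.FluidPDE.leiRenZhang2019_liouville_periodic`
(Z. Lei, X. Ren, Q. S. Zhang, arXiv:1902.11229 = Math. Ann. 383 (2022), Theorem 1.1). The proof of
Theorem 1.1 (arXiv p. 9) ends: "This shows that `Γ ≡ 0` and therefore `v = v_r e_r + v_z e_z`.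
Since the Liouville theorem for no swirl case has been proved in [5] (KNSS, Theorem 5.2), it
suffices …". This file proves that final assembly, exactly as the tree's discharge of Theorem 1.2
(`leiRenZhang2019_liouville_swirl_rate_holds`): the class bridge
`exists_jointly_measurable_axial_modification` (duality-form mild class → KNSS bounded weak class,
up to an axial constant `e(t) e_z`, which preserves axisymmetry, the swirl AND the axial
periodicity of the slices), a swirl-free statement in the bounded weak class (the hypothesis
`hfree` — the content of §§2–3, to be supplied by the periodic De Giorgi–Nash–Moser chain
`PeriodicSwirl*` / `PeriodicLog*` of this directory), KNSS Theorem 5.2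
(`KNSS2009_liouville_axisymmetric_no_swirl_holds`), and the passage from a.e. slice to every
slice (`IsBoundedAncientMildSolution.exists_ae_eq_const_slice`).

* `liouville_periodic_of_boundedWeak_swirl_free` — the statement of
  `leiRenZhang2019_liouville_periodic`, from the swirl-free theorem in the bounded weak periodic
  class.

## References

* Z. Lei, X. Ren, Q. S. Zhang, arXiv:1902.11229, proof of Theorem 1.1 (arXiv p. 9, last lines).
  [LeiRenZhang2019]
* G. Koch, N. Nadirashvili, G. Seregin, V. Šverák, Acta Math. 203 (2009), Theorem 5.2. [KNSS2009]
-/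

noncomputable section

open MeasureTheory Set Function Filter
open scoped InnerProductSpace RealInnerProductSpace

namespace Literature.Analysis.FluidPDE

namespace LeiRenZhang2019

/-- **Proof of Theorem 1.1, last step** (arXiv p. 9: "`Γ ≡ 0` and therefore `v = v_r e_r + v_z e_z`.
Since the Liouville theorem for no swirl case has been proved in [5] …"). If every bounded weak
Navier–Stokes solution (`ν = 1`) on `ℝ³ × (−∞,0)` with a.e.-axisymmetric slices, bounded swirl and
axially `P`-periodic slices (a.e., some `P > 0`) has vanishing swirl a.e., then every bounded ancient
mild solution (duality form) with measurable axisymmetric slices, bounded swirl and `P`-periodic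
slices is on every slice `t < 0` a.e. an axial constant `β e_z` — the statement of
`leiRenZhang2019_liouville_periodic`. [cite: LeiRenZhang2019, proof of Thm 1.1 (arXiv p. 9, reduction to Γ ≡ 0 and KNSS Thm 5.2)] -/
theorem liouville_periodic_of_boundedWeak_swirl_free
    (hfree : ∀ (v : ℝ → EuclideanSpace ℝ (Fin 3) → EuclideanSpace ℝ (Fin 3)) (P : ℝ), 0 < P →
      IsBoundedWeakNSSolutionOn (Iio 0) isOpen_Iio 1 v →
      (∀ θ : ℝ, ∀ᵐ t ∂((volume : Measure ℝ).restrict (Iio 0)),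
        (fun x => v t (rotZ θ x)) =ᵐ[volume] fun x => rotZ θ (v t x)) →
      (∃ C : ℝ, ∀ᵐ t ∂((volume : Measure ℝ).restrict (Iio 0)),
        ∀ᵐ x ∂(volume : Measure (EuclideanSpace ℝ (Fin 3))), |swirl (v t) x| ≤ C) →
      (∀ᵐ t ∂((volume : Measure ℝ).restrict (Iio 0)),
        (fun x => v t (x + P • eZ)) =ᵐ[volume] v t) →
      ∀ᵐ t ∂((volume : Measure ℝ).restrict (Iio 0)),
        swirl (v t) =ᵐ[volume] (0 : EuclideanSpace ℝ (Fin 3) → ℝ))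
    (u : ℝ → EuclideanSpace ℝ (Fin 3) → EuclideanSpace ℝ (Fin 3))
    (hu : IsBoundedAncientMildSolution 1 u) (hmeas : ∀ t < 0, AEStronglyMeasurable (u t) volume)
    (haxi : ∀ t < 0, IsAxisymmetric (u t))
    (hswirl : ∃ C : ℝ, ∀ t < 0, ∀ x, |swirl (u t) x| ≤ C)
    (hper : ∃ P : ℝ, 0 < P ∧ ∀ t < 0, Function.Periodic (u t) (P • eZ)) :
    ∀ t < 0, ∃ β : ℝ, u t =ᵐ[volume] fun _ => β • eZ := by
  intro t₀ ht₀
  have hν : (0 : ℝ) < 1 := one_pos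
  obtain ⟨P, hP, hPer⟩ := hper
  -- the class bridge
  obtain ⟨ũ, e, hũsol, hũjoint, hũsl, hũU⟩ := exists_jointly_measurable_axial_modification hu hmeas haxi
  have hweak : IsBoundedWeakNSSolutionOn (Iio 0) isOpen_Iio 1 ũ :=
    hũsol.isBoundedWeakNSSolutionOn hν hũjoint hũsl
  have haxiU : ∀ t < 0, IsAxisymmetric fun x => u t x + e t • eZ := fun t ht =>
    isAxisymmetric_add_smul_eZ (haxi t ht) _
  have hax : ∀ θ : ℝ, ∀ᵐ t ∂((volume : Measure ℝ).restrict (Iio 0)),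
      (fun x => ũ t (rotZ θ x)) =ᵐ[volume] fun x => rotZ θ (ũ t x) := by
    intro θ
    filter_upwards [ae_restrict_mem measurableSet_Iio] with t ht
    have e1 : (fun x => ũ t (rotZ θ x)) =ᵐ[volume] fun x => u t (rotZ θ x) + e t • eZ :=
      (measurePreserving_rotZ θ).quasiMeasurePreserving.ae (hũU t ht)
    have e2 : (fun x => rotZ θ (ũ t x)) =ᵐ[volume] fun x => rotZ θ (u t x + e t • eZ) := by
      filter_upwards [hũU t ht] with x hx
      simp only [hx]
    have e3 : (fun x => u t (rotZ θ x) + e t • eZ) =ᵐ[volume] fun x => rotZ θ (u t x + e t • eZ) :=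
      Eventually.of_forall fun x => haxiU t ht θ x
    exact e1.trans (e3.trans e2.symm)
  -- bounded swirl and periodicity survive the modification
  have hswirl' : ∃ C : ℝ, ∀ᵐ t ∂((volume : Measure ℝ).restrict (Iio 0)),
      ∀ᵐ x ∂(volume : Measure (EuclideanSpace ℝ (Fin 3))), |swirl (ũ t) x| ≤ C := by
    obtain ⟨C, hC⟩ := hswirl
    refine ⟨C, ?_⟩
    filter_upwards [ae_restrict_mem measurableSet_Iio] with t ht
    filter_upwards [hũU t ht] with x hx
    rw [show swirl (ũ t) x = swirl (fun y => u t y + e t • eZ) x by simp only [swirl, hx],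
      swirl_add_smul_eZ]
    exact hC t ht x
  have hper' : ∀ᵐ t ∂((volume : Measure ℝ).restrict (Iio 0)),
      (fun x => ũ t (x + P • eZ)) =ᵐ[volume] ũ t := by
    filter_upwards [ae_restrict_mem measurableSet_Iio] with t ht
    have hmp : MeasurePreserving (fun x : EuclideanSpace ℝ (Fin 3) => x + P • eZ) volume volume :=
      measurePreserving_add_right volume (P • eZ)
    have e1 : (fun x => ũ t (x + P • eZ)) =ᵐ[volume] fun x => u t (x + P • eZ) + e t • eZ :=
      hmp.quasiMeasurePreserving.ae (hũU t ht)
    have e2 : (fun x => u t (x + P • eZ) + e t • eZ) = fun x => u t x + e t • eZ :=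
      funext fun x => by rw [hPer t ht x]
    rw [e2] at e1
    exact e1.trans (hũU t ht).symm
  have hfreeU := hfree ũ P hP hweak hax hswirl' hper'
  -- KNSS Theorem 5.2 for the swirl-free `ũ`
  obtain ⟨b, -, -, hb⟩ := KNSS2009_liouville_axisymmetric_no_swirl_holds hweak hax hfreeU
  -- the slices of `u` are a.e. constant for a.e. `t`, hence for every `t`
  have hconst : ∀ᵐ t ∂((volume : Measure ℝ).restrict (Iio 0)),
      u t =ᵐ[volume] fun _ => (b t - e t) • eZ := by
    filter_upwards [hb, ae_restrict_mem measurableSet_Iio] with t hbt ht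
    filter_upwards [hbt, hũU t ht] with x hx hx'
    have hx2 : u t x + e t • eZ = b t • eZ := by rw [← hx']; exact hx
    have e : u t x = (u t x + e t • eZ) - e t • eZ := by abel
    rw [e, hx2, sub_smul]
  obtain ⟨κ, hκ⟩ := hu.exists_ae_eq_const_slice hν hmeas hconst t₀ ht₀
  have hax' := eq_smul_eZ_of_ae_eq_const_of_isAxisymmetric (haxi t₀ ht₀) hκ
  refine ⟨κ 2, ?_⟩
  rw [hax'] at hκ
  exact hκ

end LeiRenZhang2019

end Literature.Analysis.FluidPDE

end
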